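import Summits.AtomisticToContinuum.FouriersLaw.Theorems.VanishingNoiseTransferNoisyFourierThomsonWitnessCostsSitesAux1
import Summits.AtomisticToContinuum.FouriersLaw.Theorems.VanishingNoiseTransferNoisyFourierThomsonWitnessMoments

/-!
# The site-structured costs of the Thomson witness, II: `L`-uniform second moments of the blocks and site terms
(`--supports` file for crux `VanishingNoiseTransfer.NoisyFourier`, stmt-AtomisticToContinuum-11977, line
`abel-storage-decay`, stub B `stub_bulkAbelGKPositivity`; part W5a "WitnessL2Sites", file 2 of 4)

Setting as in part I (`…CostsSitesAux1`), plus `T > 0` and the Gibbs probability measure `μ_T = P.gibbsMeasure L T`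
(momenta i.i.d. `N(0, T)`, independent of the positions; the `L`-UNIFORM one-site moments of W4,
`…ThomsonWitnessMoments`). With constants depending on `ω₂, lam, β, T` ONLY (never on `L` or the sites):
* `exists_integral_dV_sq_le` — `∫ V'(q_l − q_k)² dμ_T ≤ C` (`V'² ≤ 4q² + 4q'² + 64β²(q⁶ + q'⁶)`);
* `exists_integral_partialQ_hamiltonian_sq_le` — `∫ (∂_{q_k}H)² dμ_T ≤ C`;
* `exists_integral_G_sq_le`, `exists_integral_G'_sq_le`, `exists_integral_K_sq_le` — `∫ G², ∫ G'², ∫ K_m² ≤ C`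
  (`G² ≤ 6β p⁴ + 2(∂_q H)²`, `K_m² ≤ 2G² + 2G'²`);
* `memLp_snd_mul_K` — `p_m K_m ∈ L²(μ_T)`; `exists_integral_sq_snd_mul_K_le` — THE SITE BOUND
  `∫ p_m² K_m² dμ_T = T ∫ K_m² dμ_T ≤ T C_K` (`K_m` is independent of `p_m`: Gaussian factorisation of W4).
Registered helper: `helper_thomsonWitnessSiteMoment`. All statements are [folklore]; axioms `propext`,
`Classical.choice`, `Quot.sound` only.
-/

noncomputable section

open MeasureTheory
open scoped BigOperators
open Literature.MathematicalPhysics.KineticTheory.HeatConduction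
open Summit.AtomisticToContinuum.FouriersLaw.Theorems.ChainVariation (sub_pow_six_le)
open Summit.AtomisticToContinuum.FouriersLaw.Cruxes.SuperadditiveResistance.InsertionToolbox
  (pinnedChain_memLp_two_of_abs_le)
open Summit.AtomisticToContinuum.FouriersLaw.Theorems.NoisyFourier.ThomsonWitness.Algebra
  (partialQ_hamiltonian_explicit contDiff_partialQ_hamiltonian)
open Summit.AtomisticToContinuum.FouriersLaw.Theorems.NoisyFourier.ThomsonWitness.Moments
  (exists_integral_fst_even_pow_le integrable_fst_pow integrable_snd_pow integral_indep_mul_snd_sq_of_abs_le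
    integral_snd_pow_four)

namespace Summit.AtomisticToContinuum.FouriersLaw.Theorems.NoisyFourier.ThomsonWitness.Costs

variable {L : ℕ} {ω₂ lam β γ : ℝ}

/-! ### A bookkeeping lemma for dominated nonnegative integrands -/

/-- If `0 ≤ f ≤ g` pointwise, `f` is a.e.-strongly measurable and `g ∈ L¹` with `∫ g ≤ C`, then `f ∈ L¹` and
`∫ f ≤ C`. [folklore] -/
theorem integrable_and_integral_le_of_le {Ω : Type*} [MeasurableSpace Ω] {μ : Measure Ω} {f g : Ω → ℝ}
    (hf : AEStronglyMeasurable f μ) (hg : Integrable g μ) (h0 : ∀ x, 0 ≤ f x) (hle : ∀ x, f x ≤ g x) {C : ℝ}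
    (hC : ∫ x, g x ∂μ ≤ C) : Integrable f μ ∧ ∫ x, f x ∂μ ≤ C := by
  have hfi : Integrable f μ :=
    hg.mono' hf (ae_of_all _ fun x => by rw [Real.norm_eq_abs, abs_of_nonneg (h0 x)]; exact hle x)
  exact ⟨hfi, (integral_mono hfi hg hle).trans hC⟩


/-! ### `L`-uniform second moments of the blocks -/

/-- `V'(x - y)² = ((x - y) + β(x - y)³)² ≤ 4x² + 4y² + 64β²x⁶ + 64β²y⁶`. [folklore] -/
theorem dV_sq_le (β x y : ℝ) :
    ((x - y) + β * (x - y) ^ 3) ^ 2 ≤ 4 * x ^ 2 + 4 * y ^ 2 + 64 * β ^ 2 * x ^ 6 + 64 * β ^ 2 * y ^ 6 := by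
  -- adapted from `ChainVariation.pinnedChain_deriv_V_sub_sq_le`
  set r := x - y with hr
  have h1 : (r + β * r ^ 3) ^ 2 ≤ 2 * r ^ 2 + 2 * β ^ 2 * r ^ 6 := by nlinarith [sq_nonneg (r - β * r ^ 3)]
  have h2 : r ^ 2 ≤ 2 * (x ^ 2 + y ^ 2) := by simp only [hr]; nlinarith [sq_nonneg (x + y)]
  have h3 : r ^ 6 ≤ 32 * (x ^ 6 + y ^ 6) := sub_pow_six_le x y
  nlinarith [sq_nonneg β, mul_nonneg (sq_nonneg β) (by positivity : (0:ℝ) ≤ x ^ 6 + y ^ 6)]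

section Uniform

variable (hω : 0 < ω₂) (hl : 0 ≤ lam) (hβ : 0 ≤ β) (γ : ℝ) {T : ℝ} (hT : 0 < T)
include hω hl hβ hT

/-- **Uniform second moment of the bond force**: `∫ V'(q_l - q_k)² dμ_T ≤ C` for every `L`, `k`, `l`
(`C` depends on `ω₂, lam, β, T` only). [folklore] -/
theorem exists_integral_dV_sq_le : ∃ C : ℝ, 0 ≤ C ∧ ∀ (L : ℕ) (k l : Fin L),
    Integrable (fun x : PhaseSpace L => ((x.1 l - x.1 k) + β * (x.1 l - x.1 k) ^ 3) ^ 2)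
        ((pinnedChain ω₂ lam β γ).gibbsMeasure L T) ∧
      ∫ x, ((x.1 l - x.1 k) + β * (x.1 l - x.1 k) ^ 3) ^ 2 ∂((pinnedChain ω₂ lam β γ).gibbsMeasure L T) ≤ C := by
  obtain ⟨C₂, hC₂0, hC₂⟩ := exists_integral_fst_even_pow_le hω hl hβ γ hT 1
  obtain ⟨C₆, hC₆0, hC₆⟩ := exists_integral_fst_even_pow_le hω hl hβ γ hT 3
  refine ⟨8 * C₂ + 128 * β ^ 2 * C₆, by positivity, fun L k l => ?_⟩
  set μ := (pinnedChain ω₂ lam β γ).gibbsMeasure L T with hμ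
  have i2 : ∀ k : Fin L, Integrable (fun x : PhaseSpace L => x.1 k ^ 2) μ := fun k =>
    integrable_fst_pow hω hl hβ γ hT L k 2
  have i6 : ∀ k : Fin L, Integrable (fun x : PhaseSpace L => x.1 k ^ 6) μ := fun k =>
    integrable_fst_pow hω hl hβ γ hT L k 6
  have e2 : ∀ k : Fin L, ∫ x, x.1 k ^ 2 ∂μ ≤ C₂ := fun k => hC₂ L k
  have e6 : ∀ k : Fin L, ∫ x, x.1 k ^ 6 ∂μ ≤ C₆ := fun k => hC₆ L k
  have hc : Continuous fun x : PhaseSpace L => ((x.1 l - x.1 k) + β * (x.1 l - x.1 k) ^ 3) ^ 2 := by fun_prop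
  have hg2 : Integrable (fun x : PhaseSpace L => 4 * x.1 l ^ 2 + 4 * x.1 k ^ 2) μ :=
    ((i2 l).const_mul 4).add ((i2 k).const_mul 4)
  have hg3 : Integrable (fun x : PhaseSpace L => 4 * x.1 l ^ 2 + 4 * x.1 k ^ 2 + 64 * β ^ 2 * x.1 l ^ 6) μ :=
    hg2.add ((i6 l).const_mul _)
  have hg : Integrable (fun x : PhaseSpace L =>
      4 * x.1 l ^ 2 + 4 * x.1 k ^ 2 + 64 * β ^ 2 * x.1 l ^ 6 + 64 * β ^ 2 * x.1 k ^ 6) μ :=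
    hg3.add ((i6 k).const_mul _)
  refine integrable_and_integral_le_of_le hc.aestronglyMeasurable hg (fun x => sq_nonneg _)
    (fun x => dV_sq_le β (x.1 l) (x.1 k)) ?_
  rw [integral_add hg3 ((i6 k).const_mul _), integral_add hg2 ((i6 l).const_mul _),
    integral_add ((i2 l).const_mul 4) ((i2 k).const_mul 4), integral_const_mul, integral_const_mul,
    integral_const_mul, integral_const_mul]
  have hβ2 : 0 ≤ β ^ 2 := sq_nonneg β
  have h6l := mul_le_mul_of_nonneg_left (e6 l) hβ2
  have h6k := mul_le_mul_of_nonneg_left (e6 k) hβ2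
  linarith [e2 l, e2 k]

/-- **Uniform second moment of the force**: `∫ (∂_{q_k} H)² dμ_T ≤ C` for every `L`, `k`. [folklore] -/
theorem exists_integral_partialQ_hamiltonian_sq_le : ∃ C : ℝ, 0 ≤ C ∧ ∀ (L : ℕ) (k : Fin L),
    Integrable (fun x : PhaseSpace L => partialQ k ((pinnedChain ω₂ lam β γ).hamiltonian L) x ^ 2)
        ((pinnedChain ω₂ lam β γ).gibbsMeasure L T) ∧
      ∫ x, partialQ k ((pinnedChain ω₂ lam β γ).hamiltonian L) x ^ 2 ∂((pinnedChain ω₂ lam β γ).gibbsMeasure L T) ≤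
        C := by
  obtain ⟨C₂, hC₂0, hC₂⟩ := exists_integral_fst_even_pow_le hω hl hβ γ hT 1
  obtain ⟨C₆, hC₆0, hC₆⟩ := exists_integral_fst_even_pow_le hω hl hβ γ hT 3
  obtain ⟨CV, hCV0, hCV⟩ := exists_integral_dV_sq_le hω hl hβ γ hT
  refine ⟨4 * ω₂ ^ 2 * C₂ + 4 * lam ^ 2 * C₆ + 4 * CV + 4 * CV, by positivity, fun L k => ?_⟩
  set μ := (pinnedChain ω₂ lam β γ).gibbsMeasure L T with hμ
  have i2 : Integrable (fun x : PhaseSpace L => x.1 k ^ 2) μ := integrable_fst_pow hω hl hβ γ hT L k 2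
  have i6 : Integrable (fun x : PhaseSpace L => x.1 k ^ 6) μ := integrable_fst_pow hω hl hβ γ hT L k 6
  have e2 : ∫ x, x.1 k ^ 2 ∂μ ≤ C₂ := hC₂ L k
  have e6 : ∫ x, x.1 k ^ 6 ∂μ ≤ C₆ := hC₆ L k
  -- the two neighbour terms, squared
  set S₁ : PhaseSpace L → ℝ := fun x =>
    ∑ l : Fin L, if l.val = k.val + 1 then ((x.1 l - x.1 k) + β * (x.1 l - x.1 k) ^ 3) else 0 with hS₁
  set S₂ : PhaseSpace L → ℝ := fun x =>
    ∑ l : Fin L, if k.val = l.val + 1 then ((x.1 k - x.1 l) + β * (x.1 k - x.1 l) ^ 3) else 0 with hS₂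
  have hI₁ : Integrable (fun x => S₁ x ^ 2) μ ∧ ∫ x, S₁ x ^ 2 ∂μ ≤ CV := by
    simp only [hS₁, sum_ite_succ_eq]
    split_ifs with h
    · exact hCV L k _
    · simp only [ne_eq, OfNat.ofNat_ne_zero, not_false_eq_true, zero_pow, integral_zero]
      exact ⟨integrable_zero _ _ _, hCV0⟩
  have hI₂ : Integrable (fun x => S₂ x ^ 2) μ ∧ ∫ x, S₂ x ^ 2 ∂μ ≤ CV := by
    simp only [hS₂, sum_ite_pred_eq]
    split_ifs with h
    · exact hCV L _ k
    · simp only [ne_eq, OfNat.ofNat_ne_zero, not_false_eq_true, zero_pow, integral_zero]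
      exact ⟨integrable_zero _ _ _, hCV0⟩
  have hpt : ∀ x : PhaseSpace L, partialQ k ((pinnedChain ω₂ lam β γ).hamiltonian L) x ^ 2 ≤
      4 * ω₂ ^ 2 * x.1 k ^ 2 + 4 * lam ^ 2 * x.1 k ^ 6 + 4 * S₁ x ^ 2 + 4 * S₂ x ^ 2 := by
    intro x
    rw [partialQ_hamiltonian_explicit]
    have e : lam * x.1 k ^ 3 = lam * x.1 k ^ 3 := rfl
    nlinarith [sq_nonneg (ω₂ * x.1 k - lam * x.1 k ^ 3), sq_nonneg (ω₂ * x.1 k + S₁ x), sq_nonneg (ω₂ * x.1 k - S₂ x),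
      sq_nonneg (lam * x.1 k ^ 3 + S₁ x), sq_nonneg (lam * x.1 k ^ 3 - S₂ x), sq_nonneg (S₁ x + S₂ x)]
  have hg2 : Integrable (fun x => 4 * ω₂ ^ 2 * x.1 k ^ 2 + 4 * lam ^ 2 * x.1 k ^ 6) μ :=
    (i2.const_mul _).add (i6.const_mul _)
  have hg3 : Integrable (fun x => 4 * ω₂ ^ 2 * x.1 k ^ 2 + 4 * lam ^ 2 * x.1 k ^ 6 + 4 * S₁ x ^ 2) μ :=
    hg2.add (hI₁.1.const_mul 4)
  have hg : Integrable (fun x => 4 * ω₂ ^ 2 * x.1 k ^ 2 + 4 * lam ^ 2 * x.1 k ^ 6 + 4 * S₁ x ^ 2 + 4 * S₂ x ^ 2) μ :=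
    hg3.add (hI₂.1.const_mul 4)
  refine integrable_and_integral_le_of_le
    ((contDiff_partialQ_hamiltonian (ω₂ := ω₂) (lam := lam) (γ := γ) k).continuous.pow 2).aestronglyMeasurable
    hg (fun x => sq_nonneg _) hpt ?_
  rw [integral_add hg3 (hI₂.1.const_mul 4), integral_add hg2 (hI₁.1.const_mul 4),
    integral_add (i2.const_mul _) (i6.const_mul _), integral_const_mul, integral_const_mul,
    integral_const_mul, integral_const_mul]
  have h2 := mul_le_mul_of_nonneg_left e2 (sq_nonneg ω₂)
  have h6 := mul_le_mul_of_nonneg_left e6 (sq_nonneg lam)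
  linarith [hI₁.2, hI₂.2]

/-- **Uniform second moment of the block `G_{ij}`**: `∫ G_{ij}² dμ_T ≤ C` for every `L`, `i`, `j`
(`G² ≤ 6β p_j⁴ + 2 (∂_{q_j}H)²`). [folklore] -/
theorem exists_integral_G_sq_le : ∃ C : ℝ, 0 ≤ C ∧ ∀ (L : ℕ) (i j : Fin L),
    Integrable (fun x : PhaseSpace L =>
        (x.2 j ^ 2 * (-(6 * β * (x.1 j - x.1 i)) / (1 + 3 * β * (x.1 j - x.1 i) ^ 2) ^ 2) -
          partialQ j ((pinnedChain ω₂ lam β γ).hamiltonian L) x * (1 / (1 + 3 * β * (x.1 j - x.1 i) ^ 2))) ^ 2)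
        ((pinnedChain ω₂ lam β γ).gibbsMeasure L T) ∧
      ∫ x, (x.2 j ^ 2 * (-(6 * β * (x.1 j - x.1 i)) / (1 + 3 * β * (x.1 j - x.1 i) ^ 2) ^ 2) -
          partialQ j ((pinnedChain ω₂ lam β γ).hamiltonian L) x * (1 / (1 + 3 * β * (x.1 j - x.1 i) ^ 2))) ^ 2
        ∂((pinnedChain ω₂ lam β γ).gibbsMeasure L T) ≤ C := by
  obtain ⟨CH, hCH0, hCH⟩ := exists_integral_partialQ_hamiltonian_sq_le hω hl hβ γ hT
  refine ⟨6 * β * (3 * T ^ 2) + 2 * CH, by positivity, fun L i j => ?_⟩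
  set μ := (pinnedChain ω₂ lam β γ).gibbsMeasure L T with hμ
  have i4 : Integrable (fun x : PhaseSpace L => x.2 j ^ 4) μ := integrable_snd_pow hω hl hβ γ hT L j 4
  have e4 : ∫ x, x.2 j ^ 4 ∂μ = 3 * T ^ 2 := integral_snd_pow_four hω hl hβ γ hT L j
  have hH := hCH L j
  have hpt : ∀ x : PhaseSpace L,
      (x.2 j ^ 2 * (-(6 * β * (x.1 j - x.1 i)) / (1 + 3 * β * (x.1 j - x.1 i) ^ 2) ^ 2) -
          partialQ j ((pinnedChain ω₂ lam β γ).hamiltonian L) x * (1 / (1 + 3 * β * (x.1 j - x.1 i) ^ 2))) ^ 2 ≤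
        6 * β * x.2 j ^ 4 + 2 * partialQ j ((pinnedChain ω₂ lam β γ).hamiltonian L) x ^ 2 := by
    intro x
    set a := x.2 j ^ 2
    set d := -(6 * β * (x.1 j - x.1 i)) / (1 + 3 * β * (x.1 j - x.1 i) ^ 2) ^ 2
    set f := 1 / (1 + 3 * β * (x.1 j - x.1 i) ^ 2)
    set h := partialQ j ((pinnedChain ω₂ lam β γ).hamiltonian L) x
    have hd : d ^ 2 ≤ 3 * β := Xv.dphi_sq_le hβ _
    have hf : f ^ 2 ≤ 1 := Xv.phi_sq_le_one hβ _
    have e : x.2 j ^ 4 = a ^ 2 := by ring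
    rw [e]
    nlinarith [sq_nonneg (a * d + h * f), mul_le_mul_of_nonneg_left hd (sq_nonneg a),
      mul_le_mul_of_nonneg_left hf (sq_nonneg h)]
  have hg : Integrable (fun x : PhaseSpace L =>
      6 * β * x.2 j ^ 4 + 2 * partialQ j ((pinnedChain ω₂ lam β γ).hamiltonian L) x ^ 2) μ :=
    (i4.const_mul _).add (hH.1.const_mul 2)
  refine integrable_and_integral_le_of_le ((continuous_G hβ i j).pow 2).aestronglyMeasurable hg
    (fun x => sq_nonneg _) hpt ?_
  rw [integral_add (i4.const_mul _) (hH.1.const_mul 2), integral_const_mul, integral_const_mul, e4]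
  linarith [hH.2]

/-- **Uniform second moment of the block `G'_{ij}`**: `∫ G'_{ij}² dμ_T ≤ C` for every `L`, `i`, `j`. [folklore] -/
theorem exists_integral_G'_sq_le : ∃ C : ℝ, 0 ≤ C ∧ ∀ (L : ℕ) (i j : Fin L),
    Integrable (fun x : PhaseSpace L =>
        (x.2 i ^ 2 * (-(6 * β * (x.1 j - x.1 i)) / (1 + 3 * β * (x.1 j - x.1 i) ^ 2) ^ 2) +
          partialQ i ((pinnedChain ω₂ lam β γ).hamiltonian L) x * (1 / (1 + 3 * β * (x.1 j - x.1 i) ^ 2))) ^ 2)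
        ((pinnedChain ω₂ lam β γ).gibbsMeasure L T) ∧
      ∫ x, (x.2 i ^ 2 * (-(6 * β * (x.1 j - x.1 i)) / (1 + 3 * β * (x.1 j - x.1 i) ^ 2) ^ 2) +
          partialQ i ((pinnedChain ω₂ lam β γ).hamiltonian L) x * (1 / (1 + 3 * β * (x.1 j - x.1 i) ^ 2))) ^ 2
        ∂((pinnedChain ω₂ lam β γ).gibbsMeasure L T) ≤ C := by
  obtain ⟨CH, hCH0, hCH⟩ := exists_integral_partialQ_hamiltonian_sq_le hω hl hβ γ hT
  refine ⟨6 * β * (3 * T ^ 2) + 2 * CH, by positivity, fun L i j => ?_⟩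
  set μ := (pinnedChain ω₂ lam β γ).gibbsMeasure L T with hμ
  have i4 : Integrable (fun x : PhaseSpace L => x.2 i ^ 4) μ := integrable_snd_pow hω hl hβ γ hT L i 4
  have e4 : ∫ x, x.2 i ^ 4 ∂μ = 3 * T ^ 2 := integral_snd_pow_four hω hl hβ γ hT L i
  have hH := hCH L i
  have hpt : ∀ x : PhaseSpace L,
      (x.2 i ^ 2 * (-(6 * β * (x.1 j - x.1 i)) / (1 + 3 * β * (x.1 j - x.1 i) ^ 2) ^ 2) +
          partialQ i ((pinnedChain ω₂ lam β γ).hamiltonian L) x * (1 / (1 + 3 * β * (x.1 j - x.1 i) ^ 2))) ^ 2 ≤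
        6 * β * x.2 i ^ 4 + 2 * partialQ i ((pinnedChain ω₂ lam β γ).hamiltonian L) x ^ 2 := by
    intro x
    set a := x.2 i ^ 2
    set d := -(6 * β * (x.1 j - x.1 i)) / (1 + 3 * β * (x.1 j - x.1 i) ^ 2) ^ 2
    set f := 1 / (1 + 3 * β * (x.1 j - x.1 i) ^ 2)
    set h := partialQ i ((pinnedChain ω₂ lam β γ).hamiltonian L) x
    have hd : d ^ 2 ≤ 3 * β := Xv.dphi_sq_le hβ _
    have hf : f ^ 2 ≤ 1 := Xv.phi_sq_le_one hβ _
    have e : x.2 i ^ 4 = a ^ 2 := by ring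
    rw [e]
    nlinarith [sq_nonneg (a * d - h * f), mul_le_mul_of_nonneg_left hd (sq_nonneg a),
      mul_le_mul_of_nonneg_left hf (sq_nonneg h)]
  have hg : Integrable (fun x : PhaseSpace L =>
      6 * β * x.2 i ^ 4 + 2 * partialQ i ((pinnedChain ω₂ lam β γ).hamiltonian L) x ^ 2) μ :=
    (i4.const_mul _).add (hH.1.const_mul 2)
  refine integrable_and_integral_le_of_le ((continuous_G' hβ i j).pow 2).aestronglyMeasurable hg
    (fun x => sq_nonneg _) hpt ?_
  rw [integral_add (i4.const_mul _) (hH.1.const_mul 2), integral_const_mul, integral_const_mul, e4]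
  linarith [hH.2]

/-- **Uniform second moment of the site coefficient**: `∫ K_m² dμ_T ≤ C_K` for every `L`, `m`
(`K_m² ≤ 2 G_{m,m+1}² + 2 G'²_{m−1,m}`). [folklore] -/
theorem exists_integral_K_sq_le : ∃ C : ℝ, 0 ≤ C ∧ ∀ (L : ℕ) (m : Fin L),
    Integrable (fun x : PhaseSpace L =>
      ((∑ j : Fin L, if j.val = m.val + 1 then
        (x.2 j ^ 2 * (-(6 * β * (x.1 j - x.1 m)) / (1 + 3 * β * (x.1 j - x.1 m) ^ 2) ^ 2) -
          partialQ j ((pinnedChain ω₂ lam β γ).hamiltonian L) x * (1 / (1 + 3 * β * (x.1 j - x.1 m) ^ 2))) else 0) +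
      (∑ i : Fin L, if m.val = i.val + 1 then
        (x.2 i ^ 2 * (-(6 * β * (x.1 m - x.1 i)) / (1 + 3 * β * (x.1 m - x.1 i) ^ 2) ^ 2) +
          partialQ i ((pinnedChain ω₂ lam β γ).hamiltonian L) x * (1 / (1 + 3 * β * (x.1 m - x.1 i) ^ 2))) else 0)) ^ 2)
        ((pinnedChain ω₂ lam β γ).gibbsMeasure L T) ∧
      ∫ x, ((∑ j : Fin L, if j.val = m.val + 1 then
        (x.2 j ^ 2 * (-(6 * β * (x.1 j - x.1 m)) / (1 + 3 * β * (x.1 j - x.1 m) ^ 2) ^ 2) -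
          partialQ j ((pinnedChain ω₂ lam β γ).hamiltonian L) x * (1 / (1 + 3 * β * (x.1 j - x.1 m) ^ 2))) else 0) +
      (∑ i : Fin L, if m.val = i.val + 1 then
        (x.2 i ^ 2 * (-(6 * β * (x.1 m - x.1 i)) / (1 + 3 * β * (x.1 m - x.1 i) ^ 2) ^ 2) +
          partialQ i ((pinnedChain ω₂ lam β γ).hamiltonian L) x * (1 / (1 + 3 * β * (x.1 m - x.1 i) ^ 2))) else 0)) ^ 2
        ∂((pinnedChain ω₂ lam β γ).gibbsMeasure L T) ≤ C := by
  obtain ⟨C₁, hC₁0, hC₁⟩ := exists_integral_G_sq_le hω hl hβ γ hT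
  obtain ⟨C₂, hC₂0, hC₂⟩ := exists_integral_G'_sq_le hω hl hβ γ hT
  refine ⟨2 * C₁ + 2 * C₂, by positivity, fun L m => ?_⟩
  set μ := (pinnedChain ω₂ lam β γ).gibbsMeasure L T with hμ
  set S₁ : PhaseSpace L → ℝ := fun x => ∑ j : Fin L, if j.val = m.val + 1 then
      (x.2 j ^ 2 * (-(6 * β * (x.1 j - x.1 m)) / (1 + 3 * β * (x.1 j - x.1 m) ^ 2) ^ 2) -
        partialQ j ((pinnedChain ω₂ lam β γ).hamiltonian L) x * (1 / (1 + 3 * β * (x.1 j - x.1 m) ^ 2))) else 0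
    with hS₁
  set S₂ : PhaseSpace L → ℝ := fun x => ∑ i : Fin L, if m.val = i.val + 1 then
      (x.2 i ^ 2 * (-(6 * β * (x.1 m - x.1 i)) / (1 + 3 * β * (x.1 m - x.1 i) ^ 2) ^ 2) +
        partialQ i ((pinnedChain ω₂ lam β γ).hamiltonian L) x * (1 / (1 + 3 * β * (x.1 m - x.1 i) ^ 2))) else 0
    with hS₂
  have hI₁ : Integrable (fun x => S₁ x ^ 2) μ ∧ ∫ x, S₁ x ^ 2 ∂μ ≤ C₁ := by
    simp only [hS₁, sum_ite_succ_eq]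
    split_ifs with h
    · exact hC₁ L m _
    · simp only [ne_eq, OfNat.ofNat_ne_zero, not_false_eq_true, zero_pow, integral_zero]
      exact ⟨integrable_zero _ _ _, hC₁0⟩
  have hI₂ : Integrable (fun x => S₂ x ^ 2) μ ∧ ∫ x, S₂ x ^ 2 ∂μ ≤ C₂ := by
    simp only [hS₂, sum_ite_pred_eq]
    split_ifs with h
    · exact hC₂ L _ m
    · simp only [ne_eq, OfNat.ofNat_ne_zero, not_false_eq_true, zero_pow, integral_zero]
      exact ⟨integrable_zero _ _ _, hC₂0⟩
  have hg : Integrable (fun x => 2 * S₁ x ^ 2 + 2 * S₂ x ^ 2) μ := (hI₁.1.const_mul 2).add (hI₂.1.const_mul 2)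
  show Integrable (fun x => (S₁ x + S₂ x) ^ 2) μ ∧ ∫ x, (S₁ x + S₂ x) ^ 2 ∂μ ≤ 2 * C₁ + 2 * C₂
  refine integrable_and_integral_le_of_le ((continuous_K hβ m).pow 2).aestronglyMeasurable hg
    (fun x => sq_nonneg _) (fun x => ?_) ?_
  · show (S₁ x + S₂ x) ^ 2 ≤ 2 * S₁ x ^ 2 + 2 * S₂ x ^ 2
    nlinarith [sq_nonneg (S₁ x - S₂ x)]
  rw [integral_add (hI₁.1.const_mul 2) (hI₂.1.const_mul 2), integral_const_mul, integral_const_mul]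
  linarith [hI₁.2, hI₂.2]

/-! ### The site terms `p_m K_m`: `L²` membership and the uniform bound `∫ p_m² K_m² = T ∫ K_m² ≤ T C_K` -/

/-- `p_m K_m ∈ L²(μ_T)`. [folklore] -/
theorem memLp_snd_mul_K (L : ℕ) (m : Fin L) :
    MemLp (fun x : PhaseSpace L => x.2 m *
      ((∑ j : Fin L, if j.val = m.val + 1 then
        (x.2 j ^ 2 * (-(6 * β * (x.1 j - x.1 m)) / (1 + 3 * β * (x.1 j - x.1 m) ^ 2) ^ 2) -
          partialQ j ((pinnedChain ω₂ lam β γ).hamiltonian L) x * (1 / (1 + 3 * β * (x.1 j - x.1 m) ^ 2))) else 0) +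
      (∑ i : Fin L, if m.val = i.val + 1 then
        (x.2 i ^ 2 * (-(6 * β * (x.1 m - x.1 i)) / (1 + 3 * β * (x.1 m - x.1 i) ^ 2) ^ 2) +
          partialQ i ((pinnedChain ω₂ lam β γ).hamiltonian L) x * (1 / (1 + 3 * β * (x.1 m - x.1 i) ^ 2))) else 0)))
      2 ((pinnedChain ω₂ lam β γ).gibbsMeasure L T) := by
  obtain ⟨C, hC0, hC⟩ := exists_abs_K_le hω hl hβ γ
  refine pinnedChain_memLp_two_of_abs_le hω hl hβ γ L hT
    ((((continuous_apply m).comp continuous_snd)).mul (continuous_K hβ m)) (C := 2 * C) (k := 4) fun x => ?_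
  rw [abs_mul]
  have h1 := abs_snd_le hω hl hβ γ x m
  have h2 := hC L m x
  have hM := one_le_one_add_hamiltonian hω hl hβ γ x (L := L)
  calc _ ≤ 2 * (1 + (pinnedChain ω₂ lam β γ).hamiltonian L x) * (C * (1 + (pinnedChain ω₂ lam β γ).hamiltonian L x) ^ 3) :=
        mul_le_mul h1 h2 (abs_nonneg _) (by positivity)
    _ = _ := by ring

/-- **The uniform site bound**: `∫ p_m² K_m² dμ_T = T ∫ K_m² dμ_T ≤ C` for every `L`, `m` (`K_m` is independent of
`p_m`; `C = T C_K` depends on `ω₂, lam, β, T` only). [folklore] -/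
theorem exists_integral_sq_snd_mul_K_le : ∃ C : ℝ, 0 ≤ C ∧ ∀ (L : ℕ) (m : Fin L),
    ∫ x, (x.2 m *
      ((∑ j : Fin L, if j.val = m.val + 1 then
        (x.2 j ^ 2 * (-(6 * β * (x.1 j - x.1 m)) / (1 + 3 * β * (x.1 j - x.1 m) ^ 2) ^ 2) -
          partialQ j ((pinnedChain ω₂ lam β γ).hamiltonian L) x * (1 / (1 + 3 * β * (x.1 j - x.1 m) ^ 2))) else 0) +
      (∑ i : Fin L, if m.val = i.val + 1 then
        (x.2 i ^ 2 * (-(6 * β * (x.1 m - x.1 i)) / (1 + 3 * β * (x.1 m - x.1 i) ^ 2) ^ 2) +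
          partialQ i ((pinnedChain ω₂ lam β γ).hamiltonian L) x * (1 / (1 + 3 * β * (x.1 m - x.1 i) ^ 2))) else 0))) ^ 2
      ∂((pinnedChain ω₂ lam β γ).gibbsMeasure L T) ≤ C := by
  obtain ⟨CK, hCK0, hCK⟩ := exists_integral_K_sq_le hω hl hβ γ hT
  obtain ⟨C, hC0, hC⟩ := exists_abs_K_le hω hl hβ γ
  refine ⟨T * CK, by positivity, fun L m => ?_⟩
  set K : PhaseSpace L → ℝ := fun x =>
      (∑ j : Fin L, if j.val = m.val + 1 then
        (x.2 j ^ 2 * (-(6 * β * (x.1 j - x.1 m)) / (1 + 3 * β * (x.1 j - x.1 m) ^ 2) ^ 2) -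
          partialQ j ((pinnedChain ω₂ lam β γ).hamiltonian L) x * (1 / (1 + 3 * β * (x.1 j - x.1 m) ^ 2))) else 0) +
      (∑ i : Fin L, if m.val = i.val + 1 then
        (x.2 i ^ 2 * (-(6 * β * (x.1 m - x.1 i)) / (1 + 3 * β * (x.1 m - x.1 i) ^ 2) ^ 2) +
          partialQ i ((pinnedChain ω₂ lam β γ).hamiltonian L) x * (1 / (1 + 3 * β * (x.1 m - x.1 i) ^ 2))) else 0)
    with hK
  have hle : ∀ x, |K x ^ 2| ≤ C ^ 2 * (1 + (pinnedChain ω₂ lam β γ).hamiltonian L x) ^ 6 := fun x => by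
    rw [abs_pow, show C ^ 2 * (1 + (pinnedChain ω₂ lam β γ).hamiltonian L x) ^ 6 =
      (C * (1 + (pinnedChain ω₂ lam β γ).hamiltonian L x) ^ 3) ^ 2 by ring]
    exact pow_le_pow_left₀ (abs_nonneg _) (hC L m x) 2
  have hind : ∀ (x : PhaseSpace L) (t : ℝ), K (x.1, Function.update x.2 m t) ^ 2 = K x ^ 2 := fun x t =>
    congrArg (fun r : ℝ => r ^ 2) (K_update_snd (ω₂ := ω₂) (lam := lam) (β := β) (γ := γ) m x t)
  have h := (integral_indep_mul_snd_sq_of_abs_le hω hl hβ γ hT L m ((continuous_K hβ m).pow 2) hle hind).1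
  show ∫ x, (x.2 m * K x) ^ 2 ∂((pinnedChain ω₂ lam β γ).gibbsMeasure L T) ≤ T * CK
  calc ∫ x, (x.2 m * K x) ^ 2 ∂((pinnedChain ω₂ lam β γ).gibbsMeasure L T)
      = ∫ x, K x ^ 2 * x.2 m ^ 2 ∂((pinnedChain ω₂ lam β γ).gibbsMeasure L T) :=
        integral_congr_ae (ae_of_all _ fun x => by ring)
    _ = T * ∫ x, K x ^ 2 ∂((pinnedChain ω₂ lam β γ).gibbsMeasure L T) := h
    _ ≤ T * CK := mul_le_mul_of_nonneg_left (hCK L m).2 hT.le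

end Uniform

/-! ### Registered helper -/

/-- Registered helper sub-goal `helper_thomsonWitnessSiteMoment` of crux stmt-AtomisticToContinuum-11977 (line
`abel-storage-decay`, stub B `stub_bulkAbelGKPositivity`, part W5a): the `L`-uniform site bound
`∫ p_m² K_m² dμ_T ≤ C` of the Thomson witness (`exists_integral_sq_snd_mul_K_le`, restated notation-free). [folklore] -/
theorem helper_thomsonWitnessSiteMoment : ∀ (ω₂ lam β γ T : ℝ), 0 < ω₂ → 0 ≤ lam → 0 ≤ β → 0 < T → ∃ C : ℝ, 0 ≤ C ∧ ∀ (L : ℕ) (m : Fin L), MeasureTheory.integral ((Literature.MathematicalPhysics.KineticTheory.HeatConduction.pinnedChain ω₂ lam β γ).gibbsMeasure L T) (fun x => (x.2 m * ((∑ j : Fin L, if j.val = m.val + 1 then (x.2 j ^ 2 * (-(6 * β * (x.1 j - x.1 m)) / (1 + 3 * β * (x.1 j - x.1 m) ^ 2) ^ 2) - Literature.MathematicalPhysics.KineticTheory.HeatConduction.partialQ j ((Literature.MathematicalPhysics.KineticTheory.HeatConduction.pinnedChain ω₂ lam β γ).hamiltonian L) x * (1 / (1 + 3 * β * (x.1 j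 - x.1 m) ^ 2))) else 0) + (∑ i : Fin L, if m.val = i.val + 1 then (x.2 i ^ 2 * (-(6 * β * (x.1 m - x.1 i)) / (1 + 3 * β * (x.1 m - x.1 i) ^ 2) ^ 2) + Literature.MathematicalPhysics.KineticTheory.HeatConduction.partialQ i ((Literature.MathematicalPhysics.KineticTheory.HeatConduction.pinnedChain ω₂ lam β γ).hamiltonian L) x * (1 / (1 + 3 * β * (x.1 m - x.1 i) ^ 2))) else 0))) ^ 2) ≤ C := by
  intro ω₂ lam β γ T hω hl hβ hT
  obtain ⟨C, hC0, hC⟩ := exists_integral_sq_snd_mul_K_le hω hl hβ γ hT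
  exact ⟨C, hC0, fun L m => hC L m⟩

end Summit.AtomisticToContinuum.FouriersLaw.Theorems.NoisyFourier.ThomsonWitness.Costs

end
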